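import Mathlib.RingTheory.RegularLocalRing.Polynomial
import Mathlib.RingTheory.PolynomialAlgebra
import Literature.AlgebraicGeometry.Resolution.RegularHomComposition
import Literature.AlgebraicGeometry.Resolution.RegularHomLocalization
import HarnessLib

/-!
# Crux `PatchingRelPerfect` (stmt-ResolutionOfSingularities-16161), chain W5.2 — F7(β) (β-AX) T0 `InitialMultiHost₂`,
# piece (B-alg) LAURENT STEP: the direction chart `κ₀[u₁, …, u_n] → κ₀[X₀, …, X_n][X_j⁻¹]`, `uᵢ ↦ X_{j⁺(i)} / X_j`,
# is a REGULAR HOMOMORPHISM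

[OURS · L1 W5.2 · rung tool; res-L1-w52-plan-1 RULING G11-27 (2) → res-D-pv-046 (B-alg `DepthMultiHost.DirectionMapRegular`,
Laurent step of the PACE 17:27Z)] Replaces the role of NO printed item of the manuscript under review; fact-free.

With `U = κ₀[u₁, …, u_n]`, `R = κ₀[X₀, …, X_n]`, `j : Fin (n+1)` and `R' = R[X_j⁻¹]`, the ring map
`θ : U → R'`, `uᵢ ↦ X_{j.succAbove i} · X_j⁻¹`, exhibits `R'` as `U[t][t⁻¹]` (`t ↦ X_j`, `X_{j.succAbove i} = uᵢ t`):
we construct the inverse isomorphisms explicitly (`IsLocalization.Away.lift` both ways, checked on generators), deduce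
`IsLocalization.Away t R'` for the `U[t]`-algebra structure, and conclude that `θ` is a regular homomorphism as the
composite of the polynomial extension `U → U[t]` (`isRegularHom_polynomial`: free, fibres `L[t]` regular) and a
localisation (`isRegularHom_of_isLocalization`).

* `isRegularHom_polynomial` — `A → A[t]` is a regular homomorphism (`A` Noetherian).
* `isRegularHom_directionChart` — `θ : κ₀[u] → κ₀[X][X_j⁻¹]` is a regular homomorphism.

## References (for the mathematics; nothing here is a statement of the manuscript under review)
* H. Matsumura, *Commutative Ring Theory* (1986), §32 p. 256 (regular homomorphisms). [Matsumura1987]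
-/

-- `Summit.<Summit>.<Sub>.Theorems` with `Sub = Summit` (single-conjunct summit, D-0017)
set_option linter.dupNamespace false

noncomputable section

open IsLocalRing TensorProduct Polynomial Literature.AlgebraicGeometry.Resolution

namespace Summit.ResolutionOfSingularities.ResolutionOfSingularities.Theorems

universe u

namespace DepthMultiHost

/-! ## §1 `A → A[t]` is a regular homomorphism -/

/-- **A polynomial extension is a regular homomorphism**: `A → A[t]` is flat (free) and its fibres
`κ(𝔭) ⊗_A A[t] = κ(𝔭)[t]` are geometrically regular (`L[t]` is a regular ring for every field `L`).
[cite: Matsumura1987, §32 p. 256] -/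
theorem isRegularHom_polynomial (A : Type u) [CommRing A] : IsRegularHom A A[X] := by
  refine ⟨inferInstance, fun p _ => ?_⟩
  intro L _ _ hL
  let e₁ : p.ResidueField ⊗[A] A[X] ≃ₐ[p.ResidueField] (p.ResidueField)[X] := (polyEquivTensor' A p.ResidueField).symm
  let e₂ : L ⊗[p.ResidueField] (p.ResidueField ⊗[A] A[X]) ≃ₐ[p.ResidueField]
      L ⊗[p.ResidueField] (p.ResidueField)[X] :=
    Algebra.TensorProduct.congr AlgEquiv.refl e₁
  let e₃ : L ⊗[p.ResidueField] (p.ResidueField)[X] ≃ₐ[p.ResidueField] L[X] := (polyEquivTensor p.ResidueField L).symm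
  exact IsRegularRing.of_ringEquiv (R := L[X]) (e₂.trans e₃).toRingEquiv.symm

/-! ## §2 The direction chart is a Laurent localisation -/

section Chart

variable (κ₀ : Type u) [Field κ₀] (n : ℕ) (j : Fin (n + 1))

/-- **The direction chart `θ : κ₀[u] → κ₀[X][X_j⁻¹]`, `uᵢ ↦ X_{j.succAbove i} X_j⁻¹`, extended by `t ↦ X_j`, makes
`κ₀[X][X_j⁻¹]` the localisation `κ₀[u][t][t⁻¹]`**: an explicit pair of inverse isomorphisms. [folklore] -/
theorem isLocalization_away_directionChart :
    letI := ((Polynomial.eval₂RingHom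
      (MvPolynomial.eval₂Hom (algebraMap κ₀ (Localization.Away (MvPolynomial.X j : MvPolynomial (Fin (n + 1)) κ₀)))
        (fun i => algebraMap (MvPolynomial (Fin (n + 1)) κ₀) (Localization.Away (MvPolynomial.X j : MvPolynomial (Fin (n + 1)) κ₀))
          (MvPolynomial.X (j.succAbove i)) * IsLocalization.Away.invSelf (MvPolynomial.X j : MvPolynomial (Fin (n + 1)) κ₀)))
      (algebraMap (MvPolynomial (Fin (n + 1)) κ₀) _ (MvPolynomial.X j : MvPolynomial (Fin (n + 1)) κ₀))) :
        (MvPolynomial (Fin n) κ₀)[X] →+* Localization.Away (MvPolynomial.X j : MvPolynomial (Fin (n + 1)) κ₀)).toAlgebra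
    IsLocalization.Away (X : (MvPolynomial (Fin n) κ₀)[X])
      (Localization.Away (MvPolynomial.X j : MvPolynomial (Fin (n + 1)) κ₀)) := by
  -- names
  let U := MvPolynomial (Fin n) κ₀
  let R := MvPolynomial (Fin (n + 1)) κ₀
  let R' := Localization.Away (MvPolynomial.X j : R)
  let Lt := Localization.Away (X : U[X])
  let θ : U →+* R' := MvPolynomial.eval₂Hom (algebraMap κ₀ R')
    (fun i => algebraMap R R' (MvPolynomial.X (j.succAbove i)) * IsLocalization.Away.invSelf (MvPolynomial.X j : R))
  let μ : U[X] →+* R' := Polynomial.eval₂RingHom θ (algebraMap R R' (MvPolynomial.X j))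
  letI algμ : Algebra U[X] R' := μ.toAlgebra
  change IsLocalization.Away (X : U[X]) R'
  -- the unit `X_j` of `R'` and its inverse
  have hXj : algebraMap R R' (MvPolynomial.X j) * IsLocalization.Away.invSelf (MvPolynomial.X j : R) = 1 :=
    IsLocalization.Away.mul_invSelf _
  have hXj_unit : IsUnit (algebraMap R R' (MvPolynomial.X j)) := IsLocalization.Away.algebraMap_isUnit _
  -- `μ` on generators
  have hμC : ∀ v : U, μ (C v) = θ v := fun v => Polynomial.eval₂_C _ _
  have hμX : μ X = algebraMap R R' (MvPolynomial.X j) := Polynomial.eval₂_X _ _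
  have hθC : ∀ c : κ₀, θ (MvPolynomial.C c) = algebraMap κ₀ R' c := fun c => MvPolynomial.eval₂Hom_C _ _ _
  have hθX : ∀ i, θ (MvPolynomial.X i) =
      algebraMap R R' (MvPolynomial.X (j.succAbove i)) * IsLocalization.Away.invSelf (MvPolynomial.X j : R) :=
    fun i => MvPolynomial.eval₂Hom_X' _ _ _
  -- the inverse direction `ρ : R' → U[t][t⁻¹]`, `X_j ↦ t`, `X_{j.succAbove i} ↦ uᵢ t`
  let T : Lt := algebraMap U[X] Lt X
  have hT : IsUnit T := IsLocalization.Away.algebraMap_isUnit _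
  let ρ₀ : R →+* Lt := MvPolynomial.eval₂Hom (algebraMap κ₀ Lt)
    (Fin.insertNth j T fun i => algebraMap U[X] Lt (C (MvPolynomial.X i)) * T)
  have hρ₀C : ∀ c : κ₀, ρ₀ (MvPolynomial.C c) = algebraMap κ₀ Lt c := fun c => MvPolynomial.eval₂Hom_C _ _ _
  have hρ₀j : ρ₀ (MvPolynomial.X j) = T := by
    change MvPolynomial.eval₂ _ _ (MvPolynomial.X j) = T
    rw [MvPolynomial.eval₂_X, Fin.insertNth_apply_same]
  have hρ₀i : ∀ i, ρ₀ (MvPolynomial.X (j.succAbove i)) = algebraMap U[X] Lt (C (MvPolynomial.X i)) * T := by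
    intro i
    change MvPolynomial.eval₂ _ _ (MvPolynomial.X _) = _
    rw [MvPolynomial.eval₂_X, Fin.insertNth_apply_succAbove]
  let ρ : R' →+* Lt := IsLocalization.Away.lift (MvPolynomial.X j) (g := ρ₀) (hρ₀j ▸ hT)
  have hρ : ∀ r : R, ρ (algebraMap R R' r) = ρ₀ r := fun r => IsLocalization.Away.lift_eq _ _ _
  -- the forward direction `Λ : U[t][t⁻¹] → R'`
  let Λ : Lt →+* R' := IsLocalization.Away.lift (X : U[X]) (g := μ) (hμX ▸ hXj_unit)
  have hΛ : ∀ p : U[X], Λ (algebraMap U[X] Lt p) = μ p := fun p => IsLocalization.Away.lift_eq _ _ _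
  -- constants agree: `κ₀ → R'` and `κ₀ → U[t][t⁻¹]`
  have hκR' : ∀ c : κ₀, algebraMap κ₀ R' c = algebraMap R R' (MvPolynomial.C c) := fun c => by
    rw [IsScalarTower.algebraMap_apply κ₀ R R', MvPolynomial.algebraMap_eq]
  have hκLt : ∀ c : κ₀, algebraMap κ₀ Lt c = algebraMap U[X] Lt (C (MvPolynomial.C c)) := fun c => by
    rw [IsScalarTower.algebraMap_apply κ₀ U Lt, IsScalarTower.algebraMap_apply U U[X] Lt, MvPolynomial.algebraMap_eq,
      Polynomial.algebraMap_eq]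
  -- `ρ (X_j⁻¹)` is the inverse of `T`
  have hρinv : ρ (IsLocalization.Away.invSelf (MvPolynomial.X j : R)) * T = 1 := by
    rw [← hρ₀j, ← hρ, ← map_mul, mul_comm, hXj, map_one]
  -- `Λ ∘ ρ = id`
  have h1 : Λ.comp ρ = RingHom.id R' := by
    refine IsLocalization.ringHom_ext (Submonoid.powers (MvPolynomial.X j : R)) ?_
    refine MvPolynomial.ringHom_ext (fun c => ?_) (fun k => ?_)
    · rw [RingHom.comp_apply, RingHom.comp_apply, RingHom.id_comp, hρ, hρ₀C, hκLt, hΛ, hμC, hθC, hκR']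
    · rw [RingHom.comp_apply, RingHom.comp_apply, RingHom.id_comp, hρ]
      rcases Fin.eq_self_or_eq_succAbove j k with rfl | ⟨i, rfl⟩
      · rw [hρ₀j, hΛ, hμX]
      · rw [hρ₀i, map_mul, hΛ, hΛ, hμC, hμX, hθX, mul_assoc, mul_comm (IsLocalization.Away.invSelf _), hXj, mul_one]
  -- `ρ ∘ Λ = id`
  have h2 : ρ.comp Λ = RingHom.id Lt := by
    refine IsLocalization.ringHom_ext (Submonoid.powers (X : U[X])) ?_
    refine Polynomial.ringHom_ext (fun v => ?_) ?_
    · rw [RingHom.comp_apply, RingHom.comp_apply, RingHom.id_comp, hΛ, hμC]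
      -- reduce to generators of `U`
      revert v
      refine fun v => congrArg (fun f : U →+* Lt => f v) (?_ : ρ.comp θ = (algebraMap U[X] Lt).comp C)
      refine MvPolynomial.ringHom_ext (fun c => ?_) (fun i => ?_)
      · rw [RingHom.comp_apply, RingHom.comp_apply, hθC, hκR', hρ, hρ₀C, hκLt]
      · rw [RingHom.comp_apply, RingHom.comp_apply, hθX, map_mul, hρ, hρ₀i, mul_assoc, mul_comm T, hρinv, mul_one]
    · rw [RingHom.comp_apply, RingHom.comp_apply, RingHom.id_comp, hΛ, hμX, hρ, hρ₀j]
  -- the isomorphism, as a `U[t]`-algebra isomorphism, and the conclusion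
  let e : Lt ≃+* R' := RingEquiv.ofRingHom Λ ρ h1 h2
  have he : ∀ p : U[X], e (algebraMap U[X] Lt p) = algebraMap U[X] R' p := fun p => hΛ p
  exact IsLocalization.isLocalization_of_algEquiv (Submonoid.powers (X : U[X])) (AlgEquiv.ofRingEquiv (f := e) he)

/-- **The direction chart is a regular homomorphism**: `θ : κ₀[u₁, …, u_n] → κ₀[X₀, …, X_n][X_j⁻¹]`,
`uᵢ ↦ X_{j.succAbove i} X_j⁻¹`, is the composite of the polynomial extension `κ₀[u] → κ₀[u][t]` and the localisation
`κ₀[u][t] → κ₀[u][t][t⁻¹] ≅ κ₀[X][X_j⁻¹]` (`isLocalization_away_directionChart`), both regular.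
[cite: Matsumura1987, §32 p. 256] -/
theorem isRegularHom_directionChart :
    letI := (MvPolynomial.eval₂Hom (algebraMap κ₀ (Localization.Away (MvPolynomial.X j : MvPolynomial (Fin (n + 1)) κ₀)))
        (fun i => algebraMap (MvPolynomial (Fin (n + 1)) κ₀) (Localization.Away (MvPolynomial.X j : MvPolynomial (Fin (n + 1)) κ₀))
          (MvPolynomial.X (j.succAbove i)) * IsLocalization.Away.invSelf (MvPolynomial.X j : MvPolynomial (Fin (n + 1)) κ₀)) :
        MvPolynomial (Fin n) κ₀ →+* Localization.Away (MvPolynomial.X j : MvPolynomial (Fin (n + 1)) κ₀)).toAlgebra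
    IsRegularHom (MvPolynomial (Fin n) κ₀) (Localization.Away (MvPolynomial.X j : MvPolynomial (Fin (n + 1)) κ₀)) := by
  let U := MvPolynomial (Fin n) κ₀
  let R := MvPolynomial (Fin (n + 1)) κ₀
  let R' := Localization.Away (MvPolynomial.X j : R)
  let θ : U →+* R' := MvPolynomial.eval₂Hom (algebraMap κ₀ R')
    (fun i => algebraMap R R' (MvPolynomial.X (j.succAbove i)) * IsLocalization.Away.invSelf (MvPolynomial.X j : R))
  let μ : U[X] →+* R' := Polynomial.eval₂RingHom θ (algebraMap R R' (MvPolynomial.X j))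
  letI algθ : Algebra U R' := θ.toAlgebra
  letI algμ : Algebra U[X] R' := μ.toAlgebra
  change IsRegularHom U R'
  haveI : IsScalarTower U U[X] R' := IsScalarTower.of_algebraMap_eq fun v => by
    change θ v = μ (algebraMap U U[X] v)
    rw [Polynomial.algebraMap_eq]
    exact (Polynomial.eval₂_C _ _).symm
  haveI : IsLocalization.Away (X : U[X]) R' := isLocalization_away_directionChart κ₀ n j
  haveI : IsNoetherianRing R' := IsLocalization.isNoetherianRing (Submonoid.powers (MvPolynomial.X j : R)) R' inferInstance
  exact (isRegularHom_polynomial U).comp (isRegularHom_of_isLocalization (Submonoid.powers (X : U[X])))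

end Chart

end DepthMultiHost

end Summit.ResolutionOfSingularities.ResolutionOfSingularities.Theorems

end
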